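import Summits.QuantumFields.BalabanUV.T4Continuum.Support.NE3CurvedFrameKill
import Summits.QuantumFields.BalabanUV.T4Continuum.Support.NE3QuadRemainderTower
import Summits.QuantumFields.BalabanUV.T4Continuum.Support.NE3ResidualSliceRep
import Summits.QuantumFields.BalabanUV.T4Continuum.Support.NE3PureGaugeFirstVariation
import Summits.QuantumFields.BalabanUV.T4Continuum.Support.MinimalActionLevels
import HarnessLib

/-!
# NE7TangentTransportGauge — THE REPAIRED TEST-FIELD TRANSPORT (TT) OF (APE), GAUGE-CORRECTED:
# `Y′ = Y + gaugeDir_U λ − R(D_U(Y + gaugeDir_U λ))` is tangent at `U`, and `|dAction U (Y′ − Y)| ≤ c_R·Λ_Q·‖Y‖₁` — the frames of the linearised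
# average are absorbed by a FINE GAUGE DIRECTION (on which the first variation vanishes EXACTLY), so only the straight double-bar tower is paid for

Cell `pub-balaban`, rung (B)+1 sub-cell t4, lineage `b2b-balaban-t4-ne7-p1`, generation 71 (CRUX PROVER NE7 #1); memo
`t4/b2b-balaban-t4-ne7-p1-g71/HUNT-H15-EXP-LANDED-TT-CURRENCY.md` §2.  File F52 (over leaf-04's `NE3TangentCovariantTower` (the structure theorem
`dirIter_eq_QbarIter_add_gaugeDir`, `dirIter_gaugeDir`, `dirIter_add`, `step_small`, the flat checks `dirIter_flat`, `QbarIter_flat`, `framePotW_flat`,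
`gaugeDir_flat`), `NE3TangentFlatStructure.iterate_Tcoarse_eq_zero_iff` ∕ `framePot_add_period`, `NE3CurvedFrameKill.framePotW_skew_periodic`,
`NE3LandauOrbit.gaugeDir_skew`, `NE3QuadRemainderTower.cpush_skew`, `AveragingDeficitMultiLevelPrep.isPeriodicDir_cpush`, `NE3ResidualSliceRep.dirIter_sub`, and
**`NE3PureGaugeFirstVariation.dAction_gaugeDir`** (the first variation vanishes on pure gauge directions, EXACTLY)).
WHY (memo H15 §1–§2).  F38's bundle asks a test-field transport `hTT`: every tangent `Y` at the flat reference has a tangent `Y′` at the representative `U = e^{A}`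
with `|dAction U (Y′ − Y)| ≤ τ‖Y‖₁`, `τ ≲ M⁻³`.  F41's `Y′ = Y − R(D_U Y)` pays `c_R·‖D_U Y‖₁`, and the FRAME part of `D_U Y` is two powers of `M` too large.
THIS FILE: with the top normalisation `cavgIter (k+1) U = 1` (a REP♭ clause), `D_U Y = Q̄_U Y − dPot(F_U Y)` and `0 = D_1 Y = Q Y − dPot(F_1 Y)`
(structure theorems), so `D_U(Y + gaugeDir_U λ) = Q̄_U Y − dPot(F_U Y) − dPot(λ∘M•) = Q̄_U Y − Q Y` for the fine gauge generator `λ = (F_1Y − F_UY)∘(·∕M)`;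
`Y′ := Y + gaugeDir_U λ − R(Q̄_U Y − Q Y)` is tangent (`R` exact) and `dAction U (Y′ − Y) = −dAction U (R(Q̄_UY − QY))` (`dAction_gaugeDir`), of size
`c_R·‖Q̄_UY − QY‖₁ ≤ c_R·Λ_Q·‖Y‖₁` — `Λ_Q = O(α̂M^{1−d})` by F50∕F51, `c_R = a·C·M^{d−2}` by route Π's (R3) + F3, so `τ ∼ δα̂M⁻³`.  The right inverse `R` enters
ABSTRACTLY (exact on skew `N`-periodic coarse data, skew periodic values, a first-variation bound `c_R`): row NE3's `rightInvW` (W5) with (R3) and F3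
`NE7OneStepLetters.abs_dAction_le_radius_mul` instantiate it (F41 §1's chain) — their modules are in the farm's broken `B7Prop4Flat` closure today.
WHAT ([folklore]; 0 def, 0 sorry).
§1 bookkeeping: `dAction_sub'` (subtraction form), **`dirIter_skew_periodic`** (skewness AND coarse periodicity of the k-fold
   linearised average in the multi-level class, one induction), `cornerLift` letters for `λ = g∘(·∕M)`: `cornerLift_smul`, `cornerLift_add_period`.
§2 **`dirIter_add_gaugeDir_eq_Qbar_sub`**: under `cavgIter (k+1) U = 1` and `D_1 Y = 0`,
   `D_U(Y + gaugeDir_U λ) z κ = QbarIter (k+1) U Y z κ − QbarIter (k+1) 1 Y z κ` for `λ = (framePot Y − framePotW U Y)∘(·∕M)`.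
§3 **`tangent_transport_gauge`** — THE REPAIRED (TT): `∃ Y′` skew periodic tangent at `U` with `|dAction U (Y′ − Y) (perWin)| ≤ c_R·Λ·dirL1 Y (periodBox)`,
   `Λ` the straight-tower letter (F50∕F51) as a hypothesis, `R` abstract.
HONEST FRAMING (page 1): lattice kinematics + the exact gauge invariance of the first variation; `R`, `Λ` and the top normalisation are HYPOTHESES; (APE) NOT
proved; NOT ONE-STEP, NOT NE7; spine 0∕9; finite T⁴ rung (B)+1 — NOT infinite volume, NOT mass gap, NOT Clay.  Continuum YM on T⁴ ⇐ BetaPertH ∧ nine spine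
estimates (0/9 proved); BetaPertH ⇐ (D1) ∧ (D4) ∧ CAP+tail; G-an2-4 gates asym, D1 and NE2/3/4.
-/

set_option autoImplicit false

open scoped BigOperators Matrix.Norms.L2Operator
open NormedSpace Finset

namespace Summit.QuantumFields.BalabanUV.T4Continuum.NE7TangentTransportGauge

open Literature.MathematicalPhysics.QuantumFieldTheory.Balaban1983to89
open B7Prop1Explicit B7Prop2Explicit MatrixLog UnitaryModel
open T4AveragingDeficitWall (IsUnitaryCfg IsSkewDir SmallField Ad curl fhol dirL1 flat_mem_classes)
open T4AveragingDeficitWallBoundary (IsPeriodicCfg periodBox)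
open AveragingDeficitPeriodicCounting (IsPeriodicDir)
open AveragingDeficitChartCalculus (cavg)
open AveragingDeficitMultiLevelPrep (cpush cavgIter LevelSmall tower natCast_tower_succ isPeriodicDir_cpush)
open AveragingDeficitFermat (isPeriodicCfg_cavg)
open MinimalActionLevels (perWin)
open BlockAveragePushDirGauge (gaugeDir isPeriodicDir_gaugeDir)
open BlockAveragePushDirSplit (flat)
open SmoothRefineNeutral (Tcoarse)
open NE3TangentNoGoWords (dPot)
open NE3TangentFlatStructure (Qcoarse framePot framePot_add_period iterate_Tcoarse_eq_zero_iff)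
open NE3TangentCovariantTower (dirIter QbarIter framePotW dirIter_succ dirIter_one cavgIter_succ step_small dirIter_add dirIter_gaugeDir
  dirIter_eq_QbarIter_add_gaugeDir dirIter_flat QbarIter_flat framePotW_flat gaugeDir_flat cavgIter_flat)
open NE3CurvedFrameKill (framePotW_skew_periodic pow_succ_mul_eq_tower)
open NE3LandauOrbit (gaugeDir_skew)
open NE3QuadRemainderTower (cpush_skew)
open NE3ResidualSliceRep (dirIter_sub)
open NE3HessForm (dAction)
open NE3PureGaugeFirstVariation (dAction_gaugeDir curl_add)

noncomputable section

variable {d : ℕ} {n : Type*} [Fintype n] [DecidableEq n]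

/-! ## §1 Bookkeeping -/

/-- `dAction` respects subtraction of directions (subtraction form of the tree's additivity). [folklore] -/
theorem dAction_sub' (V : Site d → Fin d → (Matrix n n ℂ)ˣ) (X Y : Site d → Fin d → Matrix n n ℂ)
    (W : Finset (T4AveragingDeficitWall.Plaq d)) :
    dAction V (fun y μ => X y μ - Y y μ) W = dAction V X W - dAction V Y W := by
  have hsplit : X = (fun y μ => X y μ - Y y μ) + Y := by funext y μ; simp
  have hcurl : ∀ p, curl V X p = curl V (fun y μ => X y μ - Y y μ) p + curl V Y p := fun p => by
    conv_lhs => rw [hsplit]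
    exact curl_add V _ Y p
  unfold dAction
  have hsum : ∑ p ∈ W, nReTr (curl V X p * ((fhol V p : (Matrix n n ℂ)ˣ) : Matrix n n ℂ))
      = ∑ p ∈ W, nReTr (curl V (fun y μ => X y μ - Y y μ) p * ((fhol V p : (Matrix n n ℂ)ˣ) : Matrix n n ℂ))
        + ∑ p ∈ W, nReTr (curl V Y p * ((fhol V p : (Matrix n n ℂ)ˣ) : Matrix n n ℂ)) := by
    rw [← Finset.sum_add_distrib]
    refine Finset.sum_congr rfl fun p _ => ?_
    rw [hcurl p, add_mul, T4TiltOscillation.nReTr_add]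
  rw [hsum]
  ring

/-- **SKEWNESS AND COARSE PERIODICITY OF THE k-FOLD LINEARISED AVERAGE** in the multi-level small-field class: unitary `W` of period `L^{j+1}·M`,
`0 ≤ x`, `LevelSmall d L j x`, `SmallField W x`, skew `L^{j+1}·M`-periodic `Y` ⟹ `dirIter L (j+1) W Y` is skew and `M`-periodic (one induction
through the tower: `cpush_skew`, `isPeriodicDir_cpush`, `step_small`). [folklore] -/
theorem dirIter_skew_periodic [Nonempty n] {L M : ℕ} [NeZero M] (hL : 1 ≤ L) (j : ℕ) :
    ∀ {W : Site d → Fin d → (Matrix n n ℂ)ˣ} {x : ℝ}, IsUnitaryCfg W → IsPeriodicCfg W ((tower L M (j + 1) : ℕ) : ℤ) → 0 ≤ x →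
    LevelSmall d L j x → SmallField W x → ∀ {Y : Site d → Fin d → Matrix n n ℂ}, IsSkewDir Y →
    IsPeriodicDir Y ((tower L M (j + 1) : ℕ) : ℤ) →
      IsSkewDir (dirIter L (j + 1) W Y) ∧ IsPeriodicDir (dirIter L (j + 1) W Y) (M : ℤ) := by
  induction j with
  | zero =>
      intro W x hWu hWP hx hs hWx Y hY hYP
      obtain ⟨h512, -, -, -⟩ := step_small hL hWu hx hs hWx
      have hWP' : IsPeriodicCfg W ((L : ℤ) * (tower L M 0 : ℕ)) := by rw [← natCast_tower_succ]; exact hWP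
      have hYP' : IsPeriodicDir Y ((L : ℤ) * (tower L M 0 : ℕ)) := by rw [← natCast_tower_succ]; exact hYP
      rw [zero_add, dirIter_one]
      exact ⟨cpush_skew hL hWu hx h512 hWx hY, isPeriodicDir_cpush L (tower L M 0) hWP' hYP'⟩
  | succ j ih =>
      intro W x hWu hWP hx hs hWx Y hY hYP
      obtain ⟨h512, hW₁u, hr0, hW₁x⟩ := step_small hL hWu hx hs.1 hWx
      have hWP' : IsPeriodicCfg W ((L : ℤ) * (tower L M (j + 1) : ℕ)) := by rw [← natCast_tower_succ]; exact hWP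
      have hYP' : IsPeriodicDir Y ((L : ℤ) * (tower L M (j + 1) : ℕ)) := by rw [← natCast_tower_succ]; exact hYP
      have hW₁P : IsPeriodicCfg (cavg L W) ((tower L M (j + 1) : ℕ) : ℤ) := isPeriodicCfg_cavg L _ hWP'
      have hZ : IsSkewDir (cpush L W Y) := cpush_skew hL hWu hx h512 hWx hY
      have hZP : IsPeriodicDir (cpush L W Y) ((tower L M (j + 1) : ℕ) : ℤ) := isPeriodicDir_cpush L _ hWP' hYP'
      rw [dirIter_succ]
      exact ih hW₁u hW₁P hr0 hs.2 hW₁x hZ hZP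

/-- The corner lift `λ = g∘(·∕m)` samples `g` at the corners: `λ (m•y) = g y` (`m ≠ 0`). [folklore] -/
theorem cornerLift_smul {𝔸 : Type*} (g : Site d → 𝔸) {m : ℤ} (hm : m ≠ 0) (y : Site d) :
    (fun xx : Site d => g (fun i => xx i / m)) (m • y) = g y := by
  simp only [Pi.smul_apply, smul_eq_mul]
  congr 1
  funext i
  exact Int.mul_ediv_cancel_left _ hm

/-- The corner lift of a `P`-periodic `g` is `(m·P)`-periodic (`m ≠ 0`). [folklore] -/
theorem cornerLift_add_period {𝔸 : Type*} (g : Site d → 𝔸) {m P : ℤ} (hm : m ≠ 0) (hg : ∀ (y : Site d) (i : Fin d), g (y + P • e i) = g y)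
    (xx : Site d) (i : Fin d) :
    (fun xx : Site d => g (fun j => xx j / m)) (xx + (m * P) • e i) = (fun xx : Site d => g (fun j => xx j / m)) xx := by
  have hvec : (fun j => (xx + (m * P) • e i) j / m) = (fun j => xx j / m) + P • e i := by
    funext j
    simp only [Pi.add_apply, Pi.smul_apply, smul_eq_mul, e_apply]
    by_cases hj : j = i
    · subst hj
      simp only [↓reduceIte, mul_one]
      rw [show xx j + m * P = xx j + m * P from rfl, Int.add_mul_ediv_left _ _ hm]
    · simp [hj]
  show g (fun j => (xx + (m * P) • e i) j / m) = g (fun j => xx j / m)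
  rw [hvec, hg]

/-! ## §2 The gauge-corrected direction has linearised average `Q̄_U Y − Q Y` -/

/-- **`D_U(Y + gaugeDir_U λ) = Q̄^{(k+1)}_U Y − Q^{(k+1)} Y`** for the corner lift `λ` of `framePot L (k+1) Y − framePotW L (k+1) U Y`, when the top
average of `U` is flat (`cavgIter L (k+1) U = 1`) and `Y` is tangent at the flat background (`dirIter L (k+1) 1 Y = 0`): the structure theorem at `U`
(the frame part is `−dPot(F_U Y)` at a flat top), `dirIter_gaugeDir` (`D_U(gaugeDir_U λ) = −dPot(λ∘M•)`), additivity, and the flat structure theorem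
(`Q^{(k+1)}Y = dPot(F_1 Y)`). [folklore] -/
theorem dirIter_add_gaugeDir_eq_Qbar_sub [Nonempty n] {L N : ℕ} [NeZero N] (hL : 1 ≤ L) (k : ℕ)
    {U : Site d → Fin d → (Matrix n n ℂ)ˣ} {x : ℝ} (hUu : IsUnitaryCfg U) (hUP : IsPeriodicCfg U ((tower L N (k + 1) : ℕ) : ℤ))
    (hx : 0 ≤ x) (hs : LevelSmall d L k x) (hUx : SmallField U x) (hflatTop : cavgIter L (k + 1) U = flat)
    {Y : Site d → Fin d → Matrix n n ℂ} (hY : IsSkewDir Y) (hYP : IsPeriodicDir Y ((tower L N (k + 1) : ℕ) : ℤ))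
    (hYT : dirIter L (k + 1) (flat (d := d) (n := n)) Y = 0) (z : Site d) (κ : Fin d) :
    dirIter L (k + 1) U (fun y μ => Y y μ
        + gaugeDir U (fun xx : Site d => (fun w => framePot L (k + 1) Y w - framePotW L (k + 1) U Y w) (fun i => xx i / ((L : ℤ) ^ (k + 1)))) y μ) z κ
      = QbarIter L (k + 1) U Y z κ - QbarIter L (k + 1) (flat (d := d) (n := n)) Y z κ := by
  have hm : ((L : ℤ) ^ (k + 1)) ≠ 0 := pow_ne_zero _ (by exact_mod_cast (show L ≠ 0 by omega))
  have htow : ((tower L N (k + 1) : ℕ) : ℤ) = (L : ℤ) ^ (k + 1) * (N : ℤ) := (pow_succ_mul_eq_tower L N k).symm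
  -- the two frame potentials: skew and `N`-periodic
  set g : Site d → Matrix n n ℂ := fun w => framePot L (k + 1) Y w - framePotW L (k + 1) U Y w with hg
  obtain ⟨hFUs, hFUP⟩ := framePotW_skew_periodic (M := N) hL k hUu hUP hx hs hUx hY hYP
  have hflatu : IsUnitaryCfg (flat (d := d) (n := n)) := (flat_mem_classes (d := d) (n := n) hx).1
  have hflatx : SmallField (flat (d := d) (n := n)) x := (flat_mem_classes (d := d) (n := n) hx).2
  have hflatP : IsPeriodicCfg (flat (d := d) (n := n)) ((tower L N (k + 1) : ℕ) : ℤ) := fun _ _ _ => rfl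
  obtain ⟨hF1s', hF1P'⟩ := framePotW_skew_periodic (M := N) hL k hflatu hflatP hx hs hflatx hY hYP
  have hF1s : ∀ w, framePot L (k + 1) Y w ∈ skewAdjoint (Matrix n n ℂ) := fun w => by
    rw [← framePotW_flat hL (k + 1) Y]; exact hF1s' w
  have hF1P : ∀ (w : Site d) (i : Fin d), framePot L (k + 1) Y (w + (N : ℤ) • e i) = framePot L (k + 1) Y w := fun w i => by
    rw [← framePotW_flat hL (k + 1) Y]; exact hF1P' w i
  have hgs : ∀ w, g w ∈ skewAdjoint (Matrix n n ℂ) := fun w => (skewAdjoint (Matrix n n ℂ)).sub_mem (hF1s w) (hFUs w)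
  have hgP : ∀ (w : Site d) (i : Fin d), g (w + (N : ℤ) • e i) = g w := fun w i => by simp only [hg, hF1P w i, hFUP w i]
  -- the corner lift
  set lam : Site d → Matrix n n ℂ := fun xx => g (fun i => xx i / ((L : ℤ) ^ (k + 1))) with hlam
  have hlams : ∀ xx, lam xx ∈ skewAdjoint (Matrix n n ℂ) := fun xx => hgs _
  have hlamP : ∀ (y : Site d) (i : Fin d), lam (y + ((tower L N (k + 1) : ℕ) : ℤ) • e i) = lam y := fun y i => by
    rw [htow]; exact cornerLift_add_period g hm hgP y i
  have hlam_corner : (fun y : Site d => lam (((L : ℤ) ^ (k + 1)) • y)) = g := by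
    funext y; exact cornerLift_smul g hm y
  -- the three tree identities
  have hadd := dirIter_add hL k hUu hx hs hUx Y (gaugeDir U lam)
  have hgauge := dirIter_gaugeDir (M := N) hL k hUu hUP hx hs hUx hlams hlamP
  have hstr := dirIter_eq_QbarIter_add_gaugeDir (M := N) hL k hUu hUP hx hs hUx hY hYP
  -- the flat structure theorem for the tangent `Y`
  have hQ1 : (Qcoarse L)^[k + 1] Y = dPot (framePot L (k + 1) Y) := by
    rw [← iterate_Tcoarse_eq_zero_iff hL (k + 1) Y, ← dirIter_flat hL (k + 1) Y]; exact hYT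
  -- assemble pointwise
  have h1 := congr_fun (congr_fun hadd z) κ
  have h2 := congr_fun (congr_fun hgauge z) κ
  have h3 := congr_fun (congr_fun hstr z) κ
  rw [h1, h2, h3, hflatTop, hlam_corner, gaugeDir_flat, gaugeDir_flat, QbarIter_flat hL (k + 1) Y, hQ1]
  simp only [dPot, hg]
  abel

/-! ## §3 THE REPAIRED TEST-FIELD TRANSPORT -/

/-- **THE GAUGE-CORRECTED TEST-FIELD TRANSPORT (TT) OF (APE).**  Data: `L ≥ 1`, `N ≥ 1`, `k` levels, fine period `T = L^{k+1}·N` (`tower L N (k+1)`);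
`U` unitary `T`-periodic in the multi-level class (`0 ≤ x`, `LevelSmall d L k x`, `SmallField U x`) WITH FLAT TOP AVERAGE `cavgIter L (k+1) U = 1`;
an abstract right inverse `R` of `D_U` on skew `N`-periodic coarse data (exact, skew `T`-periodic values) with the first-variation bound
`|dAction U (R φ) (perWin d T)| ≤ c_R·‖φ‖_{ℓ¹(periodBox N)}`, `c_R ≥ 0`; and the straight-tower letter
`Σ_{z∈[0,N)^d}Σ_κ‖Q̄^{(k+1)}_U Y − Q^{(k+1)}Y‖ ≤ Λ·‖Y‖_{ℓ¹(periodBox T)}` on skew `T`-periodic `Y` (F50∕F51).  THEN every skew `T`-periodic `Y` tangent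
at the flat background has a skew `T`-periodic `Y′` TANGENT AT `U` with `|dAction U (Y′ − Y) (perWin d T)| ≤ c_R·Λ·‖Y‖_{ℓ¹(periodBox T)}`:
`Y′ = Y + gaugeDir_U λ − R(D_U(Y + gaugeDir_U λ))` with §2's `λ`; the gauge part costs NOTHING (`dAction_gaugeDir`). [folklore] -/
theorem tangent_transport_gauge [Nonempty n] {L N : ℕ} [NeZero N] (hL : 1 ≤ L) (k : ℕ)
    {U : Site d → Fin d → (Matrix n n ℂ)ˣ} {x : ℝ} (hUu : IsUnitaryCfg U) (hUP : IsPeriodicCfg U ((tower L N (k + 1) : ℕ) : ℤ))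
    (hx : 0 ≤ x) (hs : LevelSmall d L k x) (hUx : SmallField U x) (hflatTop : cavgIter L (k + 1) U = flat)
    (R : (Site d → Fin d → Matrix n n ℂ) → Site d → Fin d → Matrix n n ℂ)
    (hRskew : ∀ φ : Site d → Fin d → Matrix n n ℂ, IsSkewDir φ → IsPeriodicDir φ (N : ℤ) → IsSkewDir (R φ))
    (hRper : ∀ φ : Site d → Fin d → Matrix n n ℂ, IsSkewDir φ → IsPeriodicDir φ (N : ℤ) →
      IsPeriodicDir (R φ) ((tower L N (k + 1) : ℕ) : ℤ))
    (hRexact : ∀ φ : Site d → Fin d → Matrix n n ℂ, IsSkewDir φ → IsPeriodicDir φ (N : ℤ) → dirIter L (k + 1) U (R φ) = φ)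
    {cR : ℝ} (hcR : 0 ≤ cR)
    (hRbd : ∀ φ : Site d → Fin d → Matrix n n ℂ, IsSkewDir φ → IsPeriodicDir φ (N : ℤ) →
      |dAction U (R φ) (perWin d (tower L N (k + 1)))| ≤ cR * dirL1 φ (periodBox (d := d) N))
    {Λ : ℝ}
    (hΛ : ∀ Y : Site d → Fin d → Matrix n n ℂ, IsSkewDir Y → IsPeriodicDir Y ((tower L N (k + 1) : ℕ) : ℤ) →
      ∑ z ∈ periodBox N, ∑ κ : Fin d, ‖QbarIter L (k + 1) U Y z κ - QbarIter L (k + 1) (flat (d := d) (n := n)) Y z κ‖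
        ≤ Λ * dirL1 Y (periodBox (d := d) (tower L N (k + 1)))) :
    ∀ Y : Site d → Fin d → Matrix n n ℂ, IsSkewDir Y → IsPeriodicDir Y ((tower L N (k + 1) : ℕ) : ℤ) →
      dirIter L (k + 1) (flat (d := d) (n := n)) Y = 0 →
      ∃ Y' : Site d → Fin d → Matrix n n ℂ, IsSkewDir Y' ∧ IsPeriodicDir Y' ((tower L N (k + 1) : ℕ) : ℤ) ∧ dirIter L (k + 1) U Y' = 0 ∧
        |dAction U (fun y μ => Y' y μ - Y y μ) (perWin d (tower L N (k + 1)))| ≤ cR * Λ * dirL1 Y (periodBox (d := d) (tower L N (k + 1))) := by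
  intro Y hY hYP hYT
  have hm : ((L : ℤ) ^ (k + 1)) ≠ 0 := pow_ne_zero _ (by exact_mod_cast (show L ≠ 0 by omega))
  have htow : ((tower L N (k + 1) : ℕ) : ℤ) = (L : ℤ) ^ (k + 1) * (N : ℤ) := (pow_succ_mul_eq_tower L N k).symm
  -- the generator (as in §2) and its letters
  set g : Site d → Matrix n n ℂ := fun w => framePot L (k + 1) Y w - framePotW L (k + 1) U Y w with hg
  set lam : Site d → Matrix n n ℂ := fun xx => g (fun i => xx i / ((L : ℤ) ^ (k + 1))) with hlam
  obtain ⟨hFUs, hFUP⟩ := framePotW_skew_periodic (M := N) hL k hUu hUP hx hs hUx hY hYP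
  have hflatu : IsUnitaryCfg (flat (d := d) (n := n)) := (flat_mem_classes (d := d) (n := n) hx).1
  have hflatx : SmallField (flat (d := d) (n := n)) x := (flat_mem_classes (d := d) (n := n) hx).2
  have hflatP : IsPeriodicCfg (flat (d := d) (n := n)) ((tower L N (k + 1) : ℕ) : ℤ) := fun _ _ _ => rfl
  obtain ⟨hF1s', hF1P'⟩ := framePotW_skew_periodic (M := N) hL k hflatu hflatP hx hs hflatx hY hYP
  have hgs : ∀ w, g w ∈ skewAdjoint (Matrix n n ℂ) := fun w => by
    have h1 : framePot L (k + 1) Y w ∈ skewAdjoint (Matrix n n ℂ) := by rw [← framePotW_flat hL (k + 1) Y]; exact hF1s' w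
    exact (skewAdjoint (Matrix n n ℂ)).sub_mem h1 (hFUs w)
  have hgP : ∀ (w : Site d) (i : Fin d), g (w + (N : ℤ) • e i) = g w := fun w i => by
    have h1 : framePot L (k + 1) Y (w + (N : ℤ) • e i) = framePot L (k + 1) Y w := by
      rw [← framePotW_flat hL (k + 1) Y]; exact hF1P' w i
    simp only [hg, h1, hFUP w i]
  have hlams : ∀ xx, lam xx ∈ skewAdjoint (Matrix n n ℂ) := fun xx => hgs _
  have hlamP : ∀ (y : Site d) (i : Fin d), lam (y + ((tower L N (k + 1) : ℕ) : ℤ) • e i) = lam y := fun y i => by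
    rw [htow]; exact cornerLift_add_period g hm hgP y i
  -- the gauge-corrected direction and its average
  set G : Site d → Fin d → Matrix n n ℂ := gaugeDir U lam with hG
  have hGs : IsSkewDir G := gaugeDir_skew hUu hlams
  have hGP : IsPeriodicDir G ((tower L N (k + 1) : ℕ) : ℤ) := isPeriodicDir_gaugeDir hUP hlamP
  set Y₁ : Site d → Fin d → Matrix n n ℂ := fun y μ => Y y μ + G y μ with hY₁
  have hY₁s : IsSkewDir Y₁ := fun y μ => (skewAdjoint (Matrix n n ℂ)).add_mem (hY y μ) (hGs y μ)
  have hY₁P : IsPeriodicDir Y₁ ((tower L N (k + 1) : ℕ) : ℤ) := fun y i μ => by simp only [hY₁, hYP y i μ, hGP y i μ]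
  set ψ : Site d → Fin d → Matrix n n ℂ := dirIter L (k + 1) U Y₁ with hψ
  obtain ⟨hψs, hψP⟩ := dirIter_skew_periodic (M := N) hL k hUu hUP hx hs hUx hY₁s hY₁P
  have hψeq : ∀ (z : Site d) (κ : Fin d), ψ z κ = QbarIter L (k + 1) U Y z κ - QbarIter L (k + 1) (flat (d := d) (n := n)) Y z κ :=
    fun z κ => dirIter_add_gaugeDir_eq_Qbar_sub hL k hUu hUP hx hs hUx hflatTop hY hYP hYT z κ
  -- the transported direction
  refine ⟨fun y μ => Y₁ y μ - R ψ y μ, ?_, ?_, ?_, ?_⟩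
  · exact fun y μ => (skewAdjoint (Matrix n n ℂ)).sub_mem (hY₁s y μ) (hRskew ψ hψs hψP y μ)
  · intro y i μ
    simp only [hY₁P y i μ, hRper ψ hψs hψP y i μ]
  · rw [dirIter_sub hL k hUu hx hs hUx Y₁ (R ψ), hRexact ψ hψs hψP]
    funext z κ
    simp [hψ]
  · -- dAction U (Y' − Y) = dAction U G − dAction U (R ψ) = −dAction U (R ψ)
    have e1 : (fun y μ => (fun y μ => Y₁ y μ - R ψ y μ) y μ - Y y μ) = fun y μ => G y μ - R ψ y μ := by
      funext y μ; simp only [hY₁]; abel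
    rw [e1, dAction_sub', hG, dAction_gaugeDir, zero_sub, abs_neg]
    refine (hRbd ψ hψs hψP).trans ?_
    have hψ1 : dirL1 ψ (periodBox (d := d) N) ≤ Λ * dirL1 Y (periodBox (d := d) (tower L N (k + 1))) := by
      unfold dirL1
      have := hΛ Y hY hYP
      calc ∑ z ∈ periodBox N, ∑ κ : Fin d, ‖ψ z κ‖
          = ∑ z ∈ periodBox N, ∑ κ : Fin d, ‖QbarIter L (k + 1) U Y z κ - QbarIter L (k + 1) (flat (d := d) (n := n)) Y z κ‖ := by
            simp only [hψeq]
        _ ≤ Λ * dirL1 Y (periodBox (d := d) (tower L N (k + 1))) := this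
    calc cR * dirL1 ψ (periodBox (d := d) N) ≤ cR * (Λ * dirL1 Y (periodBox (d := d) (tower L N (k + 1)))) :=
          mul_le_mul_of_nonneg_left hψ1 hcR
      _ = cR * Λ * dirL1 Y (periodBox (d := d) (tower L N (k + 1))) := by ring

end

end Summit.QuantumFields.BalabanUV.T4Continuum.NE7TangentTransportGauge

-- Build-lane re-trigger (custody by lineage t4-ne7-p2, gen 85, 2026-08-24; the file and its pid of record p371951 are the OWNER t4-ne7-p1's):
-- comment-only re-land of the tree bytes f10c1721d38302a9; every declaration byte-identical.  Accepted 2026-08-23T21:26Z inside the no-olean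
-- cohort of `ops/buildfix/UNBUILT-ACCEPTED-20260824T1600.txt` l.165 (last build event rc 75 NO-HOST, attempt 62); F53 p374021 has been deferred 74 times
-- on `…NE7TangentTransportGauge:no-olean`.  Cf. ops-buildfix-2's comment-only re-land p372431 of `B7Prop4Flat`.
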